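import Literature.Topology.FourManifolds.RegularLevelCollar
import Literature.Topology.FourManifolds.TrisectionsSectorAtlas
import HarnessLib

/-!
# Bi-collar coordinates `(s, r, z)` near a surface `F ⊂ Y ⊂ X` cut out by two functions, and
# the corner-slice charts of wedge-shaped sectors along `F`

Topic `Literature/Topology/FourManifolds`; infrastructure for the fact seat
`provefact-Literature.Topology.FourManifolds.exists_isBalancedGKTrisection` (Gay–Kirby 2016,
Thm. 4 via Lemma 14).  Everything in this file is **proved**; no named facts are introduced.

In Gay–Kirby's construction the three sectors of the trisection meet along the central surface
`F`, which is a regular level `g = b` of a function `g` (a Heegaard function) on the closed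
`3`-manifold `Y = ∂X₁ = f⁻¹(a)`, itself a regular level of a Morse function `f` on the closed
`4`-manifold `X`.  Near `F` the sectors are, in the coordinates `s = f - a` (normal to `Y`)
and `r = g - b` (normal to `F` inside `Y`), *wedges* `{L(s, r) ∈ Q}` for linear automorphisms
`L` of `ℝ²` (three convex sectors of the `(s, r)`-plane with angles summing to `2π`,
Gay–Kirby's Fig. 1), and the corner clause of `Literature.Topology.FourManifolds.IsGKTrisection`
asks for corner charts of each sector along `F`.  `TrisectionsSectorAtlas.lean` reduces this to
the construction of **corner-slice charts** (`Literature.Topology.FourManifolds.CornerSliceChart`):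
local diffeomorphisms `Θ = (u, v, t)` of `X` in which the sector is the quadrant, with common
normal coordinates `u, v` and tangential coordinates `t` factoring through a retraction `π`
onto `F`.  This file builds them from the **bi-collar** of `F`:

* `Literature.Topology.FourManifolds.BiCollar X` — the data: `f`, a regular level `a` with a
  unit-speed field `U` across it (`Literature.Topology.FourManifolds.LevelUnitField`,
  `RegularLevelCollar.lean`), a smooth `g` on the level manifold `Y = RegularLevel hf` with a
  regular level `b` and a unit-speed field `V` across it, `F = RegularLevel hg` nonempty;
* the coordinates `B.sFun = f - a`, `B.yL : X → Y` (drop along `U`), `B.rFun = g ∘ yL - b`,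
  `B.zL : X → F` (drop along `V` after `U`), the retraction `B.π x = zL x ∈ F ⊂ X`, and the
  parametrisation `B.Ψ z r s = U.fl (V.fl z r) s` ("flow out of `F` inside `Y` for time `r`,
  then out of `Y` for time `s`"), with `s (Ψ z r s) = s`, `r (Ψ z r s) = r`, `zL (Ψ z r s) = z`
  and `Ψ (zL x) (r x) (s x) = x` on the bi-collar box `{|s| < ε, |r| < ε}`
  (`BiCollar.sFun_Ψ`, `rFun_Ψ`, `zL_Ψ`, `Ψ_zL`), smoothness of all of these;
* for a linear automorphism `L` of `ℝ²`, a chart `χ` of `F` and `ε` small: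
  **`BiCollar.wedgeChart`** — the local diffeomorphism `Θ x = (L (s x, r x), χ (zL x))` of `X`
  onto an open subset of `ℝ⁴` (an `OpenPartialHomeomorph` with `C^∞` inverse
  `w ↦ Ψ (χ⁻¹ (w₂, w₃)) (L⁻¹ (w₀, w₁))`), and **`BiCollar.cornerSliceChart`** — `Θ` is a
  corner-slice chart for every `S, K ⊆ X` which, on the box, are the wedge `{L(s, r) ∈ Q}` and
  the surface `{s = r = 0} = F`, with `u, v` the components of `L(s, r)` and `π` as above
  (`CornerSliceChart.mem_iff`, `apply_π : Θ (π x) = (0, 0, χ (zL x))`, `mapsTo_π`).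

## References

* D. Gay, R. Kirby, *Trisecting 4-manifolds*, Geom. Topol. 20 (2016) 3097–3132
  (arXiv:1205.1565): Def. 1 and Fig. 1; §4, Lemma 14 (the sectors near `F ⊂ ∂X₁`). [GayKirby2016]
* J. Milnor, *Lectures on the h-cobordism theorem* (1965), Thm. 3.4 and its proof (product
  neighbourhoods of regular levels). [MilnorHCobordism1965]
* A. Douady, *Variétés à bord anguleux et voisinages tubulaires*, Séminaire H. Cartan 14
  (1961/62), exp. 1, §1 and §4. [Douady1961]
-/

open scoped Manifold ContDiff Topology
open Set Function

noncomputable section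

universe u

namespace Literature.Topology.FourManifolds

/-- Local notation: `𝔼 n` is the model Euclidean space `EuclideanSpace ℝ (Fin n)`. -/
local notation "𝔼 " n:arg => EuclideanSpace ℝ (Fin n)

variable (X : Type u) [TopologicalSpace X] [T2Space X] [CompactSpace X]
  [ChartedSpace (𝔼 4) X] [IsManifold (𝓡 4) ∞ X]

/-- **Bi-collar data** on a closed `4`-manifold `X`: a smooth function `f` with a regular level
`a` and a unit-speed field `U` across it, and on the level `Y = f⁻¹(a)` (a closed `3`-manifold,
`Literature.Topology.FourManifolds.RegularLevel`) a smooth function `g` with a regular level `b`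
and a unit-speed field `V` across it, the surface `F = g⁻¹(b) ⊂ Y` being nonempty.  In
Gay–Kirby's Lemma 14: `f` the Morse function of the handle decomposition, `a = 3/2`,
`Y = ∂X₁`, `g` a Heegaard function of `∂X₁ = H₁₂ ∪_F H₃₁`. [cite: GayKirby2016, §4, Lemma 14] -/
structure BiCollar where
  /-- The function on `X`. -/
  f : X → ℝ
  /-- Its regular level. -/
  a : ℝ
  /-- `a` is a regular level of `f`. -/
  hf : IsRegularLevel (𝓡 4) f a
  /-- A unit-speed field across the level `f = a`. -/
  U : LevelUnitField 3 f a
  /-- The function on the level `Y = f⁻¹(a)`. -/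
  g : RegularLevel hf → ℝ
  /-- Its regular level. -/
  b : ℝ
  /-- `b` is a regular level of `g`. -/
  hg : IsRegularLevel (𝓡 3) g b
  /-- A unit-speed field across the level `g = b` inside `Y`. -/
  V : LevelUnitField 2 g b
  /-- The surface `F = g⁻¹(b)` is nonempty. -/
  nonempty_F : Nonempty (RegularLevel hg)

namespace BiCollar

variable {X} (B : BiCollar X)

/-- The level `Y = f⁻¹(a)`, a closed `3`-manifold. [cite: GayKirby2016, §4, Lemma 14] -/
abbrev Y : Type u := RegularLevel B.hf

/-- The surface `F = g⁻¹(b) ⊂ Y`, a closed `2`-manifold. [cite: GayKirby2016, §4, Lemma 14] -/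
abbrev F : Type u := RegularLevel B.hg

omit [T2Space X] [CompactSpace X] in
/-- `Y ⊇ F` is nonempty. [folklore] -/
theorem nonempty_Y : Nonempty B.Y := ⟨RegularLevel.incl B.hg (Classical.choice B.nonempty_F)⟩

/-! ### The coordinates `s`, `r`, the drops `yL`, `zL`, the retraction `π` -/

/-- The normal coordinate to `Y`: `s = f - a`. [cite: GayKirby2016, §4, Lemma 14] -/
def sFun (x : X) : ℝ := B.f x - B.a

/-- The drop of `X` onto `Y` along the field `U` (meaningful on the band of `U`). [cite: MilnorHCobordism1965, proof of Thm. 3.4] -/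
def yL (x : X) : B.Y := haveI := B.nonempty_Y; B.U.dropLift B.hf x

/-- The normal coordinate to `F` inside `Y`, transported to `X`: `r = g (yL x) - b`.
[cite: GayKirby2016, §4, Lemma 14] -/
def rFun (x : X) : ℝ := B.g (B.yL x) - B.b

/-- The drop of `X` onto `F`: drop onto `Y` along `U`, then onto `F` along `V`.
[cite: MilnorHCobordism1965, proof of Thm. 3.4] -/
def zL (x : X) : B.F := haveI := B.nonempty_F; B.V.dropLift B.hg (B.yL x)

/-- The tangential retraction onto the surface: `π x = zL x`, as a point of `X`.
[cite: Douady1961, §1 and §4] -/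
def π (x : X) : X := RegularLevel.incl B.hf (RegularLevel.incl B.hg (B.zL x))

/-- **The bi-collar parametrisation** `Ψ z r s = U.fl (V.fl z r) s`: flow out of `F` inside `Y`
for time `r`, then out of `Y` for time `s`. [cite: MilnorHCobordism1965, proof of Thm. 3.4] -/
def Ψ (z : B.F) (r s : ℝ) : X := B.U.fl (RegularLevel.incl B.hf (B.V.fl (RegularLevel.incl B.hg z) r)) s

/-- The bi-collar **box** of radius `ε`: `{|s| < ε, |r| < ε}` (for `ε ≤ δ_U`, `ε ≤ δ_V` it lies
in both bands). [cite: MilnorHCobordism1965, proof of Thm. 3.4] -/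
def box (ε : ℝ) : Set X := {x | |B.sFun x| < ε ∧ |B.rFun x| < ε}

variable {B}

/-- Membership in the box (definitional). [folklore] -/
theorem mem_box_iff {ε : ℝ} {x : X} : x ∈ B.box ε ↔ |B.sFun x| < ε ∧ |B.rFun x| < ε := Iff.rfl

variable (B)

omit [T2Space X] [CompactSpace X] in
/-- `f = a + s` (definitional). [folklore] -/
theorem f_eq_add_sFun (x : X) : B.f x = B.a + B.sFun x := by rw [sFun]; ring

omit [T2Space X] [CompactSpace X] in
/-- A point with `|s| < δ_U` lies in the band of `U`. [folklore] -/
theorem mem_band_U {x : X} (hx : |B.sFun x| < B.U.δ) : x ∈ B.U.band := by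
  rw [LevelUnitField.mem_band_iff, B.f_eq_add_sFun]
  rw [abs_lt] at hx
  exact ⟨by linarith [hx.1], by linarith [hx.2]⟩

/-- A point with `|r| < δ_V` drops into the band of `V`. [folklore] -/
theorem yL_mem_band_V {x : X} (hx : |B.rFun x| < B.V.δ) : B.yL x ∈ B.V.band := by
  rw [LevelUnitField.mem_band_iff]
  have : B.g (B.yL x) = B.b + B.rFun x := by rw [rFun]; ring
  rw [this]
  rw [abs_lt] at hx
  exact ⟨by linarith [hx.1], by linarith [hx.2]⟩

/-- On the band of `U`, `yL x` is the drop of `x` onto `Y`. [cite: MilnorHCobordism1965, proof of Thm. 3.4] -/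
theorem incl_yL {x : X} (hx : x ∈ B.U.band) : RegularLevel.incl B.hf (B.yL x) = B.U.drop x := by
  haveI := B.nonempty_Y
  exact B.U.incl_dropLift B.hf hx

/-- On the band of `V`, `zL x` is the drop of `yL x` onto `F`. [cite: MilnorHCobordism1965, proof of Thm. 3.4] -/
theorem incl_zL {x : X} (hx : B.yL x ∈ B.V.band) : RegularLevel.incl B.hg (B.zL x) = B.V.drop (B.yL x) := by
  haveI := B.nonempty_F
  exact B.V.incl_dropLift B.hg hx

/-- `yL` of a point of `Y` is that point. [cite: MilnorHCobordism1965, proof of Thm. 3.4] -/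
theorem yL_incl (y : B.Y) : B.yL (RegularLevel.incl B.hf y) = y := by
  apply (RegularLevel.isEmbedding_incl B.hf).injective
  have h := B.incl_yL (B.U.mem_band_of_apply_eq y.2)
  exact h.trans (B.U.drop_of_apply_eq y.2)

/-- `zL` of a point of `F` is that point. [cite: MilnorHCobordism1965, proof of Thm. 3.4] -/
theorem zL_incl_incl (z : B.F) : B.zL (RegularLevel.incl B.hf (RegularLevel.incl B.hg z)) = z := by
  rw [zL, yL_incl]
  apply (RegularLevel.isEmbedding_incl B.hg).injective
  haveI := B.nonempty_F
  have h := B.V.incl_dropLift B.hg (x := RegularLevel.incl B.hg z) (B.V.mem_band_of_apply_eq z.2)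
  exact h.trans (B.V.drop_of_apply_eq z.2)

omit [T2Space X] [CompactSpace X] in
/-- `s = 0` on `Y`. [folklore] -/
theorem sFun_incl (y : B.Y) : B.sFun (RegularLevel.incl B.hf y) = 0 := by
  rw [sFun, RegularLevel.apply_incl B.hf y, sub_self]

/-- `r = 0` on `F`. [folklore] -/
theorem rFun_incl_incl (z : B.F) : B.rFun (RegularLevel.incl B.hf (RegularLevel.incl B.hg z)) = 0 := by
  rw [rFun, yL_incl, RegularLevel.apply_incl B.hg z, sub_self]

/-! ### The bi-collar parametrisation: identities -/

/-- `yL` after flowing along `U` from a point of `Y` for a time in `(-δ_U, δ_U)` returns the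
starting point. [cite: MilnorHCobordism1965, proof of Thm. 3.4] -/
theorem yL_fl (y : B.Y) {s : ℝ} (hs : s ∈ Ioo (-B.U.δ) B.U.δ) : B.yL (B.U.fl (RegularLevel.incl B.hf y) s) = y := by
  apply (RegularLevel.isEmbedding_incl B.hf).injective
  have h := B.incl_yL (B.U.fl_mem_band y.2 hs)
  exact h.trans (B.U.drop_fl_of_apply_eq y.2 hs)

/-- **`s (Ψ z r s) = s`** for `|s| < δ_U`. [cite: MilnorHCobordism1965, proof of Thm. 3.4] -/
theorem sFun_Ψ (z : B.F) (r : ℝ) {s : ℝ} (hs : s ∈ Ioo (-B.U.δ) B.U.δ) : B.sFun (B.Ψ z r s) = s := by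
  rw [sFun, Ψ, B.U.apply_fl_of_apply_eq (B.V.fl (RegularLevel.incl B.hg z) r).2 hs]
  ring

/-- **`yL (Ψ z r s) = V.fl z r`** for `|s| < δ_U`. [cite: MilnorHCobordism1965, proof of Thm. 3.4] -/
theorem yL_Ψ (z : B.F) (r : ℝ) {s : ℝ} (hs : s ∈ Ioo (-B.U.δ) B.U.δ) :
    B.yL (B.Ψ z r s) = B.V.fl (RegularLevel.incl B.hg z) r :=
  B.yL_fl _ hs

/-- **`r (Ψ z r s) = r`** for `|s| < δ_U`, `|r| < δ_V`. [cite: MilnorHCobordism1965, proof of Thm. 3.4] -/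
theorem rFun_Ψ (z : B.F) {r s : ℝ} (hr : r ∈ Ioo (-B.V.δ) B.V.δ) (hs : s ∈ Ioo (-B.U.δ) B.U.δ) :
    B.rFun (B.Ψ z r s) = r := by
  rw [rFun, B.yL_Ψ z r hs, B.V.apply_fl_of_apply_eq z.2 hr]
  ring

/-- **`zL (Ψ z r s) = z`** for `|s| < δ_U`, `|r| < δ_V`. [cite: MilnorHCobordism1965, proof of Thm. 3.4] -/
theorem zL_Ψ (z : B.F) {r s : ℝ} (hr : r ∈ Ioo (-B.V.δ) B.V.δ) (hs : s ∈ Ioo (-B.U.δ) B.U.δ) :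
    B.zL (B.Ψ z r s) = z := by
  rw [zL, B.yL_Ψ z r hs]
  apply (RegularLevel.isEmbedding_incl B.hg).injective
  haveI := B.nonempty_F
  have h := B.V.incl_dropLift B.hg (x := B.V.fl (RegularLevel.incl B.hg z) r) (B.V.fl_mem_band z.2 hr)
  exact h.trans (B.V.drop_fl_of_apply_eq z.2 hr)

/-- **`Ψ (zL x) (r x) (s x) = x`** on the bands (`|s x| < δ_U`, `|r x| < δ_V`): the bi-collar
parametrisation inverts the coordinates. [cite: MilnorHCobordism1965, proof of Thm. 3.4] -/
theorem Ψ_zL {x : X} (hs : |B.sFun x| < B.U.δ) (hr : |B.rFun x| < B.V.δ) :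
    B.Ψ (B.zL x) (B.rFun x) (B.sFun x) = x := by
  have hxU := B.mem_band_U hs
  have hyV := B.yL_mem_band_V hr
  rw [Ψ, B.incl_zL hyV, rFun, B.V.fl_drop, B.incl_yL hxU, sFun, B.U.fl_drop]

/-- Points of the form `Ψ z r s` with `|s| < ε ≤ δ_U`, `|r| < ε ≤ δ_V` lie in the box of radius
`ε`. [folklore] -/
theorem Ψ_mem_box {ε : ℝ} (hεU : ε ≤ B.U.δ) (hεV : ε ≤ B.V.δ) (z : B.F) {r s : ℝ} (hr : |r| < ε)
    (hs : |s| < ε) : B.Ψ z r s ∈ B.box ε := by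
  have hs' : s ∈ Ioo (-B.U.δ) B.U.δ := by
    rw [abs_lt] at hs; exact ⟨by linarith [hs.1], by linarith [hs.2]⟩
  have hr' : r ∈ Ioo (-B.V.δ) B.V.δ := by
    rw [abs_lt] at hr; exact ⟨by linarith [hr.1], by linarith [hr.2]⟩
  rw [mem_box_iff, B.sFun_Ψ z r hs', B.rFun_Ψ z hr' hs']
  exact ⟨hs, hr⟩

/-- The retraction in terms of `Ψ`: `π x = Ψ (zL x) 0 0`. [cite: Douady1961, §1 and §4] -/
theorem π_eq_Ψ (x : X) : B.π x = B.Ψ (B.zL x) 0 0 := by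
  rw [π, Ψ, B.V.fl_zero, B.U.fl_zero]

/-- `s (π x) = 0`. [cite: Douady1961, §1 and §4] -/
theorem sFun_π (x : X) : B.sFun (B.π x) = 0 := B.sFun_incl _

/-- `r (π x) = 0`. [cite: Douady1961, §1 and §4] -/
theorem rFun_π (x : X) : B.rFun (B.π x) = 0 := B.rFun_incl_incl _

/-- `zL (π x) = zL x`. [cite: Douady1961, §1 and §4] -/
theorem zL_π (x : X) : B.zL (B.π x) = B.zL x := B.zL_incl_incl _

/-- `π x` lies in every box of positive radius. [folklore] -/
theorem π_mem_box {ε : ℝ} (hε : 0 < ε) (x : X) : B.π x ∈ B.box ε := by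
  rw [mem_box_iff, sFun_π, rFun_π, abs_zero]
  exact ⟨hε, hε⟩

/-! ### Smoothness of the coordinates -/

omit [T2Space X] [CompactSpace X] in
/-- `s` is smooth. [folklore] -/
theorem contMDiff_sFun : ContMDiff (𝓡 4) 𝓘(ℝ, ℝ) ∞ B.sFun :=
  B.U.contMDiff_f.sub contMDiff_const

/-- `yL` is smooth on the band of `U`. [cite: MilnorHCobordism1965, proof of Thm. 3.4] -/
theorem contMDiffOn_yL : ContMDiffOn (𝓡 4) (𝓡 3) ∞ B.yL B.U.band := by
  haveI := B.nonempty_Y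
  exact B.U.contMDiffOn_dropLift B.hf

/-- `r` is smooth on the band of `U`. [cite: MilnorHCobordism1965, proof of Thm. 3.4] -/
theorem contMDiffOn_rFun : ContMDiffOn (𝓡 4) 𝓘(ℝ, ℝ) ∞ B.rFun B.U.band :=
  (B.hg.contMDiff.comp_contMDiffOn B.contMDiffOn_yL).sub contMDiffOn_const

/-- `r` is continuous on the band of `U`. [folklore] -/
theorem continuousOn_rFun : ContinuousOn B.rFun B.U.band := B.contMDiffOn_rFun.continuousOn

/-- The open set `{|s| < δ_U, |r| < δ_V}` on which `zL` is smooth. [folklore] -/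
theorem isOpen_box_bands : IsOpen {x : X | |B.sFun x| < B.U.δ ∧ |B.rFun x| < B.V.δ} := by
  have h1 : IsOpen {x : X | |B.sFun x| < B.U.δ} :=
    isOpen_lt (continuous_abs.comp B.contMDiff_sFun.continuous) continuous_const
  have h2 : IsOpen (B.U.band ∩ B.rFun ⁻¹' (abs ⁻¹' Iio B.V.δ)) :=
    B.continuousOn_rFun.isOpen_inter_preimage B.U.isOpen_band (isOpen_Iio.preimage continuous_abs)
  have : {x : X | |B.sFun x| < B.U.δ ∧ |B.rFun x| < B.V.δ} =
      {x : X | |B.sFun x| < B.U.δ} ∩ (B.U.band ∩ B.rFun ⁻¹' (abs ⁻¹' Iio B.V.δ)) := by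
    ext x
    simp only [mem_setOf_eq, mem_inter_iff, mem_preimage, mem_Iio]
    exact ⟨fun h => ⟨h.1, B.mem_band_U h.1, h.2⟩, fun h => ⟨h.1, h.2.2⟩⟩
  rw [this]
  exact h1.inter h2

/-- The box of radius `ε ≤ min δ_U δ_V` is open. [folklore] -/
theorem isOpen_box {ε : ℝ} (hεU : ε ≤ B.U.δ) : IsOpen (B.box ε) := by
  have h1 : IsOpen {x : X | |B.sFun x| < ε} :=
    isOpen_lt (continuous_abs.comp B.contMDiff_sFun.continuous) continuous_const
  have h2 : IsOpen (B.U.band ∩ B.rFun ⁻¹' (abs ⁻¹' Iio ε)) :=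
    B.continuousOn_rFun.isOpen_inter_preimage B.U.isOpen_band (isOpen_Iio.preimage continuous_abs)
  have : B.box ε = {x : X | |B.sFun x| < ε} ∩ (B.U.band ∩ B.rFun ⁻¹' (abs ⁻¹' Iio ε)) := by
    ext x
    simp only [mem_box_iff, mem_setOf_eq, mem_inter_iff, mem_preimage, mem_Iio]
    exact ⟨fun h => ⟨h.1, B.mem_band_U (h.1.trans_le hεU), h.2⟩, fun h => ⟨h.1, h.2.2⟩⟩
  rw [this]
  exact h1.inter h2

/-- `zL` is smooth on `{|s| < δ_U, |r| < δ_V}`. [cite: MilnorHCobordism1965, proof of Thm. 3.4] -/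
theorem contMDiffOn_zL : ContMDiffOn (𝓡 4) (𝓡 2) ∞ B.zL {x : X | |B.sFun x| < B.U.δ ∧ |B.rFun x| < B.V.δ} := by
  haveI := B.nonempty_F
  exact (B.V.contMDiffOn_dropLift B.hg).comp (B.contMDiffOn_yL.mono fun _ hx => B.mem_band_U hx.1)
    fun _ hx => B.yL_mem_band_V hx.2

/-- `Ψ` is smooth jointly in `(z, r, s)`. [cite: MilnorHCobordism1965, proof of Thm. 3.4] -/
theorem contMDiff_Ψ : ContMDiff (((𝓡 2).prod 𝓘(ℝ, ℝ)).prod 𝓘(ℝ, ℝ)) (𝓡 4) ∞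
    fun p : (B.F × ℝ) × ℝ => B.Ψ p.1.1 p.1.2 p.2 := by
  have h1 : ContMDiff ((𝓡 2).prod 𝓘(ℝ, ℝ)) (𝓡 3) ∞ fun q : B.F × ℝ => B.V.fl (RegularLevel.incl B.hg q.1) q.2 :=
    B.V.contMDiff_fl.comp ((RegularLevel.contMDiff_incl B.hg).prodMap contMDiff_id)
  have h2 : ContMDiff (((𝓡 2).prod 𝓘(ℝ, ℝ)).prod 𝓘(ℝ, ℝ)) ((𝓡 4).prod 𝓘(ℝ, ℝ)) ∞
      fun p : (B.F × ℝ) × ℝ => (RegularLevel.incl B.hf (B.V.fl (RegularLevel.incl B.hg p.1.1) p.1.2), p.2) :=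
    (((RegularLevel.contMDiff_incl B.hf).comp h1).comp contMDiff_fst).prodMk contMDiff_snd
  exact B.U.contMDiff_fl.comp h2

/-- `π` is smooth on `{|s| < δ_U, |r| < δ_V}`. [cite: Douady1961, §1 and §4] -/
theorem contMDiffOn_π : ContMDiffOn (𝓡 4) (𝓡 4) ∞ B.π {x : X | |B.sFun x| < B.U.δ ∧ |B.rFun x| < B.V.δ} :=
  ((RegularLevel.contMDiff_incl B.hf).comp (RegularLevel.contMDiff_incl B.hg)).comp_contMDiffOn
    B.contMDiffOn_zL

end BiCollar

/-! ### Linear wedges in the `(s, r)`-plane -/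

/-- A **linear wedge frame**: an invertible `2 × 2` real matrix `(α β; γ δ)`, giving the normal
coordinates `u = α s + β r`, `v = γ s + δ r` in which a convex sector of the `(s, r)`-plane with
apex at the origin becomes the quadrant `{u ≥ 0, v ≥ 0}` (Gay–Kirby's Fig. 1: three sectors of
a disc). [cite: GayKirby2016, Def. 1 and Fig. 1] -/
structure WedgeFrame where
  /-- Matrix entry. -/
  α : ℝ
  /-- Matrix entry. -/
  β : ℝ
  /-- Matrix entry. -/
  γ : ℝ
  /-- Matrix entry. -/
  δ : ℝ
  /-- The matrix is invertible. -/
  det_ne_zero : α * δ - β * γ ≠ 0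

namespace WedgeFrame

variable (W : WedgeFrame)

/-- The first normal coordinate `u = α s + β r`. [cite: GayKirby2016, Def. 1 and Fig. 1] -/
def u (s r : ℝ) : ℝ := W.α * s + W.β * r

/-- The second normal coordinate `v = γ s + δ r`. [cite: GayKirby2016, Def. 1 and Fig. 1] -/
def v (s r : ℝ) : ℝ := W.γ * s + W.δ * r

/-- The determinant `D = α δ - β γ`. [folklore] -/
def D : ℝ := W.α * W.δ - W.β * W.γ

/-- `D ≠ 0`. [folklore] -/
theorem D_ne_zero : W.D ≠ 0 := W.det_ne_zero

/-- Recovering `s` from `(u, v)`: `s = (δ u - β v) / D`. [folklore] -/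
def sOf (u v : ℝ) : ℝ := (W.δ * u - W.β * v) / W.D

/-- Recovering `r` from `(u, v)`: `r = (α v - γ u) / D`. [folklore] -/
def rOf (u v : ℝ) : ℝ := (W.α * v - W.γ * u) / W.D

/-- `sOf (u s r) (v s r) = s`. [folklore] -/
@[simp] theorem sOf_u_v (s r : ℝ) : W.sOf (W.u s r) (W.v s r) = s := by
  have hD : W.α * W.δ - W.β * W.γ ≠ 0 := W.det_ne_zero
  unfold sOf u v D
  rw [div_eq_iff hD]
  ring

/-- `rOf (u s r) (v s r) = r`. [folklore] -/
@[simp] theorem rOf_u_v (s r : ℝ) : W.rOf (W.u s r) (W.v s r) = r := by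
  have hD : W.α * W.δ - W.β * W.γ ≠ 0 := W.det_ne_zero
  unfold rOf u v D
  rw [div_eq_iff hD]
  ring

/-- `u (sOf u₀ v₀) (rOf u₀ v₀) = u₀`. [folklore] -/
@[simp] theorem u_sOf_rOf (u₀ v₀ : ℝ) : W.u (W.sOf u₀ v₀) (W.rOf u₀ v₀) = u₀ := by
  have hD : W.α * W.δ - W.β * W.γ ≠ 0 := W.det_ne_zero
  unfold sOf rOf u D
  rw [mul_div_assoc', mul_div_assoc', ← add_div, div_eq_iff hD]
  ring

/-- `v (sOf u₀ v₀) (rOf u₀ v₀) = v₀`. [folklore] -/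
@[simp] theorem v_sOf_rOf (u₀ v₀ : ℝ) : W.v (W.sOf u₀ v₀) (W.rOf u₀ v₀) = v₀ := by
  have hD : W.α * W.δ - W.β * W.γ ≠ 0 := W.det_ne_zero
  unfold sOf rOf v D
  rw [mul_div_assoc', mul_div_assoc', ← add_div, div_eq_iff hD]
  ring

/-- `u 0 0 = 0`. [folklore] -/
@[simp] theorem u_zero_zero : W.u 0 0 = 0 := by simp [u]

/-- `v 0 0 = 0`. [folklore] -/
@[simp] theorem v_zero_zero : W.v 0 0 = 0 := by simp [v]

/-- `u = v = 0 ↔ s = r = 0`. [folklore] -/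
theorem u_eq_zero_and_v_eq_zero_iff (s r : ℝ) : W.u s r = 0 ∧ W.v s r = 0 ↔ s = 0 ∧ r = 0 := by
  constructor
  · rintro ⟨hu, hv⟩
    have hs := W.sOf_u_v s r
    have hr := W.rOf_u_v s r
    rw [hu, hv] at hs hr
    simp only [sOf, rOf, mul_zero, sub_zero, zero_div] at hs hr
    exact ⟨hs.symm, hr.symm⟩
  · rintro ⟨rfl, rfl⟩
    exact ⟨W.u_zero_zero, W.v_zero_zero⟩

end WedgeFrame

/-! ### The wedge chart `Θ = (u, v, χ ∘ zL)` -/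

namespace BiCollar

variable {X} (B : BiCollar X) (W : WedgeFrame) (χ : OpenPartialHomeomorph B.F (𝔼 2)) (ε : ℝ)

/-- The normal coordinate `u = α s + β r` as a function on `X`. [cite: GayKirby2016, Def. 1 and Fig. 1] -/
def uFun (x : X) : ℝ := W.u (B.sFun x) (B.rFun x)

/-- The normal coordinate `v = γ s + δ r` as a function on `X`. [cite: GayKirby2016, Def. 1 and Fig. 1] -/
def vFun (x : X) : ℝ := W.v (B.sFun x) (B.rFun x)

/-- **The wedge chart as a function**: `Θ x = (u x, v x, χ (zL x))`. [cite: Douady1961, §1 and §4] -/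
def wedgeFun (x : X) : 𝔼 4 := !₂[B.uFun W x, B.vFun W x, χ (B.zL x) 0, χ (B.zL x) 1]

/-- The tangential part `(w₂, w₃)` of a vector of `ℝ⁴`, as a vector of `ℝ²`. [folklore] -/
def tail2 (w : 𝔼 4) : 𝔼 2 := !₂[w 2, w 3]

/-- **The inverse of the wedge chart as a function**:
`w ↦ Ψ (χ⁻¹ (w₂, w₃)) (rOf (w₀, w₁)) (sOf (w₀, w₁))`. [cite: Douady1961, §1 and §4] -/
def wedgeInv (w : 𝔼 4) : X := B.Ψ (χ.symm (tail2 w)) (W.rOf (w 0) (w 1)) (W.sOf (w 0) (w 1))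

/-- The source of the wedge chart: the box of radius `ε` cut down to `zL⁻¹(χ.source)`.
[cite: Douady1961, §1 and §4] -/
def wedgeSource : Set X := B.box ε ∩ B.zL ⁻¹' χ.source

/-- The target of the wedge chart. [cite: Douady1961, §1 and §4] -/
def wedgeTarget : Set (𝔼 4) :=
  {w | |W.sOf (w 0) (w 1)| < ε ∧ |W.rOf (w 0) (w 1)| < ε ∧ tail2 w ∈ χ.target}

variable {B W χ ε}

/-- Coordinate `0` of the wedge chart is `u`. [folklore] -/
@[simp] theorem wedgeFun_apply_zero (x : X) : B.wedgeFun W χ x 0 = B.uFun W x := rfl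
/-- Coordinate `1` of the wedge chart is `v`. [folklore] -/
@[simp] theorem wedgeFun_apply_one (x : X) : B.wedgeFun W χ x 1 = B.vFun W x := rfl
/-- Coordinate `2` of the wedge chart. [folklore] -/
@[simp] theorem wedgeFun_apply_two (x : X) : B.wedgeFun W χ x 2 = χ (B.zL x) 0 := rfl
/-- Coordinate `3` of the wedge chart. [folklore] -/
@[simp] theorem wedgeFun_apply_three (x : X) : B.wedgeFun W χ x 3 = χ (B.zL x) 1 := rfl
/-- Coordinate `0` of `tail2 w` is `w₂`. [folklore] -/
@[simp] theorem tail2_apply_zero (w : 𝔼 4) : tail2 w 0 = w 2 := rfl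
/-- Coordinate `1` of `tail2 w` is `w₃`. [folklore] -/
@[simp] theorem tail2_apply_one (w : 𝔼 4) : tail2 w 1 = w 3 := rfl

/-- The tangential part of the wedge chart is `χ ∘ zL`. [folklore] -/
theorem tail2_wedgeFun (x : X) : tail2 (B.wedgeFun W χ x) = χ (B.zL x) := by
  ext i; fin_cases i <;> rfl

/-- `sOf` of the wedge chart is `s`. [folklore] -/
theorem sOf_wedgeFun (x : X) : W.sOf (B.wedgeFun W χ x 0) (B.wedgeFun W χ x 1) = B.sFun x :=
  W.sOf_u_v _ _

/-- `rOf` of the wedge chart is `r`. [folklore] -/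
theorem rOf_wedgeFun (x : X) : W.rOf (B.wedgeFun W χ x 0) (B.wedgeFun W χ x 1) = B.rFun x :=
  W.rOf_u_v _ _

/-- Membership in the wedge source (definitional). [folklore] -/
theorem mem_wedgeSource_iff {x : X} : x ∈ B.wedgeSource χ ε ↔ x ∈ B.box ε ∧ B.zL x ∈ χ.source := Iff.rfl

omit [T2Space X] [CompactSpace X] in
/-- Membership in the wedge target (definitional). [folklore] -/
theorem mem_wedgeTarget_iff {w : 𝔼 4} : w ∈ B.wedgeTarget W χ ε ↔
    |W.sOf (w 0) (w 1)| < ε ∧ |W.rOf (w 0) (w 1)| < ε ∧ tail2 w ∈ χ.target := Iff.rfl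

/-- The wedge chart maps its source into its target. [cite: Douady1961, §1 and §4] -/
theorem wedgeFun_mem_target {x : X} (hx : x ∈ B.wedgeSource χ ε) : B.wedgeFun W χ x ∈ B.wedgeTarget W χ ε := by
  rw [mem_wedgeTarget_iff, sOf_wedgeFun, rOf_wedgeFun, tail2_wedgeFun]
  exact ⟨hx.1.1, hx.1.2, χ.map_source hx.2⟩

/-- The inverse maps the target into the source (`ε ≤ δ_U`, `ε ≤ δ_V`). [cite: Douady1961, §1 and §4] -/
theorem wedgeInv_mem_source (hεU : ε ≤ B.U.δ) (hεV : ε ≤ B.V.δ) {w : 𝔼 4} (hw : w ∈ B.wedgeTarget W χ ε) :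
    B.wedgeInv W χ w ∈ B.wedgeSource χ ε := by
  obtain ⟨hs, hr, ht⟩ := hw
  refine ⟨B.Ψ_mem_box hεU hεV _ hr hs, ?_⟩
  show B.zL (B.Ψ _ _ _) ∈ χ.source
  have hs' : W.sOf (w 0) (w 1) ∈ Ioo (-B.U.δ) B.U.δ := by
    rw [abs_lt] at hs; exact ⟨by linarith [hs.1], by linarith [hs.2]⟩
  have hr' : W.rOf (w 0) (w 1) ∈ Ioo (-B.V.δ) B.V.δ := by
    rw [abs_lt] at hr; exact ⟨by linarith [hr.1], by linarith [hr.2]⟩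
  rw [B.zL_Ψ _ hr' hs']
  exact χ.map_target ht

/-- **Left inverse**: `wedgeInv (wedgeFun x) = x` on the source (`ε ≤ δ_U`, `ε ≤ δ_V`).
[cite: Douady1961, §1 and §4] -/
theorem wedgeInv_wedgeFun (hεU : ε ≤ B.U.δ) (hεV : ε ≤ B.V.δ) {x : X} (hx : x ∈ B.wedgeSource χ ε) :
    B.wedgeInv W χ (B.wedgeFun W χ x) = x := by
  rw [wedgeInv, tail2_wedgeFun, χ.left_inv hx.2, sOf_wedgeFun, rOf_wedgeFun]
  exact B.Ψ_zL (hx.1.1.trans_le hεU) (hx.1.2.trans_le hεV)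

/-- **Right inverse**: `wedgeFun (wedgeInv w) = w` on the target (`ε ≤ δ_U`, `ε ≤ δ_V`).
[cite: Douady1961, §1 and §4] -/
theorem wedgeFun_wedgeInv (hεU : ε ≤ B.U.δ) (hεV : ε ≤ B.V.δ) {w : 𝔼 4} (hw : w ∈ B.wedgeTarget W χ ε) :
    B.wedgeFun W χ (B.wedgeInv W χ w) = w := by
  obtain ⟨hs, hr, ht⟩ := hw
  have hs' : W.sOf (w 0) (w 1) ∈ Ioo (-B.U.δ) B.U.δ := by
    rw [abs_lt] at hs; exact ⟨by linarith [hs.1], by linarith [hs.2]⟩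
  have hr' : W.rOf (w 0) (w 1) ∈ Ioo (-B.V.δ) B.V.δ := by
    rw [abs_lt] at hr; exact ⟨by linarith [hr.1], by linarith [hr.2]⟩
  have hz : B.zL (B.wedgeInv W χ w) = χ.symm (tail2 w) := B.zL_Ψ _ hr' hs'
  have hsw : B.sFun (B.wedgeInv W χ w) = W.sOf (w 0) (w 1) := B.sFun_Ψ _ _ hs'
  have hrw : B.rFun (B.wedgeInv W χ w) = W.rOf (w 0) (w 1) := B.rFun_Ψ _ hr' hs'
  have hχ : χ (χ.symm (tail2 w)) = tail2 w := χ.right_inv ht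
  ext i
  fin_cases i
  · show B.uFun W (B.wedgeInv W χ w) = w 0
    rw [uFun, hsw, hrw, W.u_sOf_rOf]
  · show B.vFun W (B.wedgeInv W χ w) = w 1
    rw [vFun, hsw, hrw, W.v_sOf_rOf]
  · show χ (B.zL (B.wedgeInv W χ w)) 0 = w 2
    rw [hz, hχ]; rfl
  · show χ (B.zL (B.wedgeInv W χ w)) 1 = w 3
    rw [hz, hχ]; rfl

/-! #### Smoothness of the wedge chart and of its inverse -/

variable (B W)

/-- `u` is smooth on the band of `U`. [folklore] -/
theorem contMDiffOn_uFun : ContMDiffOn (𝓡 4) 𝓘(ℝ, ℝ) ∞ (B.uFun W) B.U.band :=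
  ((contMDiffOn_const.mul B.contMDiff_sFun.contMDiffOn).add (contMDiffOn_const.mul B.contMDiffOn_rFun))

/-- `v` is smooth on the band of `U`. [folklore] -/
theorem contMDiffOn_vFun : ContMDiffOn (𝓡 4) 𝓘(ℝ, ℝ) ∞ (B.vFun W) B.U.band :=
  ((contMDiffOn_const.mul B.contMDiff_sFun.contMDiffOn).add (contMDiffOn_const.mul B.contMDiffOn_rFun))

variable (χ ε)

/-- **The wedge chart is smooth on its source** (for a chart `χ` of the maximal atlas of `F`
and `ε ≤ δ_U`, `ε ≤ δ_V`). [cite: Douady1961, §1 and §4] -/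
theorem contMDiffOn_wedgeFun (hχ : χ ∈ IsManifold.maximalAtlas (𝓡 2) ∞ B.F) (hεU : ε ≤ B.U.δ)
    (hεV : ε ≤ B.V.δ) : ContMDiffOn (𝓡 4) 𝓘(ℝ, 𝔼 4) ∞ (B.wedgeFun W χ) (B.wedgeSource χ ε) := by
  have hsub : B.wedgeSource χ ε ⊆ B.U.band := fun x hx => B.mem_band_U (hx.1.1.trans_le hεU)
  have hsub' : B.wedgeSource χ ε ⊆ {x : X | |B.sFun x| < B.U.δ ∧ |B.rFun x| < B.V.δ} :=
    fun x hx => ⟨hx.1.1.trans_le hεU, hx.1.2.trans_le hεV⟩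
  -- the tangential part `χ ∘ zL`
  have hχz : ContMDiffOn (𝓡 4) 𝓘(ℝ, 𝔼 2) ∞ (fun x => χ (B.zL x)) (B.wedgeSource χ ε) :=
    (contMDiffOn_of_mem_maximalAtlas hχ).comp (B.contMDiffOn_zL.mono hsub') fun x hx => hx.2
  have hc2 : ∀ i : Fin 2, ContDiff ℝ ∞ fun w : 𝔼 2 => w i := fun i => contDiff_euclidean.mp contDiff_id i
  have hχi : ∀ i : Fin 2, ContMDiffOn (𝓡 4) 𝓘(ℝ, ℝ) ∞ (fun x => χ (B.zL x) i) (B.wedgeSource χ ε) :=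
    fun i x hx => (hc2 i).comp_contMDiffWithinAt (hχz x hx)
  have h : ContMDiffOn (𝓡 4) 𝓘(ℝ, Fin 4 → ℝ) ∞
      (fun x => ![B.uFun W x, B.vFun W x, χ (B.zL x) 0, χ (B.zL x) 1]) (B.wedgeSource χ ε) := by
    rw [contMDiffOn_pi_space]
    intro i
    fin_cases i
    · exact (B.contMDiffOn_uFun W).mono hsub
    · exact (B.contMDiffOn_vFun W).mono hsub
    · exact hχi 0
    · exact hχi 1
  exact fun x hx => (PiLp.contDiff_toLp (p := 2)).comp_contMDiffWithinAt (h x hx)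

/-- The coordinate functions of `ℝ⁴` are smooth. [folklore] -/
private theorem contDiff_coord4 (i : Fin 4) : ContDiff ℝ ∞ fun w : 𝔼 4 => w i :=
  contDiff_euclidean.mp contDiff_id i

/-- `tail2` is smooth. [folklore] -/
theorem contDiff_tail2 : ContDiff ℝ ∞ tail2 := by
  have h : ContDiff ℝ ∞ (fun w : 𝔼 4 => ![w 2, w 3]) := by
    rw [contDiff_pi]
    intro i
    fin_cases i
    · exact contDiff_coord4 2
    · exact contDiff_coord4 3
  exact (PiLp.contDiff_toLp (p := 2)).comp h

/-- `w ↦ sOf (w₀, w₁)` is smooth. [folklore] -/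
theorem contDiff_sOf_coord : ContDiff ℝ ∞ fun w : 𝔼 4 => W.sOf (w 0) (w 1) := by
  unfold WedgeFrame.sOf
  exact ((contDiff_const.mul (contDiff_coord4 0)).sub (contDiff_const.mul (contDiff_coord4 1))).div_const _

/-- `w ↦ rOf (w₀, w₁)` is smooth. [folklore] -/
theorem contDiff_rOf_coord : ContDiff ℝ ∞ fun w : 𝔼 4 => W.rOf (w 0) (w 1) := by
  unfold WedgeFrame.rOf
  exact ((contDiff_const.mul (contDiff_coord4 1)).sub (contDiff_const.mul (contDiff_coord4 0))).div_const _

/-- **The inverse of the wedge chart is smooth on the target** (for a chart `χ` of the maximal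
atlas of `F`). [cite: Douady1961, §1 and §4] -/
theorem contMDiffOn_wedgeInv (hχ : χ ∈ IsManifold.maximalAtlas (𝓡 2) ∞ B.F) :
    ContMDiffOn 𝓘(ℝ, 𝔼 4) (𝓡 4) ∞ (B.wedgeInv W χ) (B.wedgeTarget W χ ε) := by
  have hz : ContMDiffOn 𝓘(ℝ, 𝔼 4) (𝓡 2) ∞ (fun w => χ.symm (tail2 w)) (B.wedgeTarget W χ ε) :=
    (contMDiffOn_symm_of_mem_maximalAtlas hχ).comp contDiff_tail2.contMDiff.contMDiffOn
      fun w hw => hw.2.2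
  have hin : ContMDiffOn 𝓘(ℝ, 𝔼 4) (((𝓡 2).prod 𝓘(ℝ, ℝ)).prod 𝓘(ℝ, ℝ)) ∞
      (fun w => ((χ.symm (tail2 w), W.rOf (w 0) (w 1)), W.sOf (w 0) (w 1))) (B.wedgeTarget W χ ε) :=
    (hz.prodMk (contDiff_rOf_coord W).contMDiff.contMDiffOn).prodMk
      (contDiff_sOf_coord W).contMDiff.contMDiffOn
  exact B.contMDiff_Ψ.comp_contMDiffOn hin

/-! #### The wedge chart as a local diffeomorphism of `X` -/

/-- The source of the wedge chart is open (`ε ≤ δ_U`, `ε ≤ δ_V`). [folklore] -/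
theorem isOpen_wedgeSource (hεU : ε ≤ B.U.δ) (hεV : ε ≤ B.V.δ) : IsOpen (B.wedgeSource χ ε) :=
  (B.contMDiffOn_zL.mono fun _ hx => ⟨hx.1.trans_le hεU, hx.2.trans_le hεV⟩).continuousOn.isOpen_inter_preimage
    (B.isOpen_box hεU) χ.open_source

omit [T2Space X] [CompactSpace X] in
/-- The target of the wedge chart is open. [folklore] -/
theorem isOpen_wedgeTarget : IsOpen (B.wedgeTarget W χ ε) := by
  refine (isOpen_lt (continuous_abs.comp (contDiff_sOf_coord W).continuous) continuous_const).inter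
    ((isOpen_lt (continuous_abs.comp (contDiff_rOf_coord W).continuous) continuous_const).inter ?_)
  exact χ.open_target.preimage contDiff_tail2.continuous

/-- **The wedge chart** `Θ = (u, v, χ ∘ zL)`: a local diffeomorphism of `X` onto an open subset
of `ℝ⁴`, as an open partial homeomorphism (with `C^∞` inverse, `contMDiffOn_wedgeInv`), for a
chart `χ` of the maximal atlas of `F` and `0 < ε ≤ min δ_U δ_V`. [cite: Douady1961, §1 and §4] -/
def wedgeChart (hχ : χ ∈ IsManifold.maximalAtlas (𝓡 2) ∞ B.F) (hεU : ε ≤ B.U.δ) (hεV : ε ≤ B.V.δ) :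
    OpenPartialHomeomorph X (𝔼 4) where
  toFun := B.wedgeFun W χ
  invFun := B.wedgeInv W χ
  source := B.wedgeSource χ ε
  target := B.wedgeTarget W χ ε
  map_source' _ hx := wedgeFun_mem_target hx
  map_target' _ hw := wedgeInv_mem_source hεU hεV hw
  left_inv' _ hx := wedgeInv_wedgeFun hεU hεV hx
  right_inv' _ hw := wedgeFun_wedgeInv hεU hεV hw
  open_source := isOpen_wedgeSource B χ ε hεU hεV
  open_target := isOpen_wedgeTarget B W χ ε
  continuousOn_toFun := (contMDiffOn_wedgeFun B W χ ε hχ hεU hεV).continuousOn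
  continuousOn_invFun := (contMDiffOn_wedgeInv B W χ ε hχ).continuousOn

/-- The wedge chart, as a function (definitional). [folklore] -/
@[simp] theorem wedgeChart_apply (hχ : χ ∈ IsManifold.maximalAtlas (𝓡 2) ∞ B.F) (hεU : ε ≤ B.U.δ)
    (hεV : ε ≤ B.V.δ) (x : X) : B.wedgeChart W χ ε hχ hεU hεV x = B.wedgeFun W χ x := rfl

/-- The source of the wedge chart (definitional). [folklore] -/
theorem wedgeChart_source (hχ : χ ∈ IsManifold.maximalAtlas (𝓡 2) ∞ B.F) (hεU : ε ≤ B.U.δ)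
    (hεV : ε ≤ B.V.δ) : (B.wedgeChart W χ ε hχ hεU hεV).source = B.wedgeSource χ ε := rfl

/-! ### The corner-slice chart of a wedge sector -/

/-- **The corner-slice chart of a wedge-shaped sector along `F`.**  Let `S, K ⊆ X` be, on the
bi-collar box of radius `ε`, the wedge `{u ≥ 0, v ≥ 0}` and the surface `{s = r = 0} = F`.  Then
the wedge chart is a corner-slice chart for `S` with corner locus `K`, normal coordinates
`u, v` and tangential retraction `π` (`Literature.Topology.FourManifolds.CornerSliceChart`): in
it `S` is the model quadrant, `Θ ∘ π = stratumProj ∘ Θ`, `π` preserves the source, and `K` is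
the corner stratum.  This is the input of `Literature.Topology.FourManifolds.CornerSliceAtlas`
for the sectors of Gay–Kirby's Lemma 14 near the central surface. [cite: GayKirby2016, Def. 1 and Fig. 1] -/
def cornerSliceChart (hχ : χ ∈ IsManifold.maximalAtlas (𝓡 2) ∞ B.F) (hε : 0 < ε) (hεU : ε ≤ B.U.δ)
    (hεV : ε ≤ B.V.δ) {S K : Set X}
    (hS : ∀ x ∈ B.box ε, x ∈ S ↔ 0 ≤ B.uFun W x ∧ 0 ≤ B.vFun W x)
    (hK : ∀ x ∈ B.box ε, x ∈ K ↔ B.sFun x = 0 ∧ B.rFun x = 0) :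
    CornerSliceChart S K (B.uFun W) (B.vFun W) B.π where
  Θ := B.wedgeChart W χ ε hχ hεU hεV
  contMDiffOn_toFun := contMDiffOn_wedgeFun B W χ ε hχ hεU hεV
  contMDiffOn_symm := contMDiffOn_wedgeInv B W χ ε hχ
  mem_iff q hq := by
    rw [hS q hq.1]
    exact Iff.rfl
  apply_zero _ _ := rfl
  apply_one _ _ := rfl
  mapsTo_π q hq := ⟨B.π_mem_box hε q, show B.zL (B.π q) ∈ χ.source by rw [B.zL_π]; exact hq.2⟩
  apply_π q _ := by
    show B.wedgeFun W χ (B.π q) = stratumProj (B.wedgeFun W χ q)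
    ext i
    fin_cases i
    · show B.uFun W (B.π q) = 0
      rw [uFun, B.sFun_π, B.rFun_π, W.u_zero_zero]
    · show B.vFun W (B.π q) = 0
      rw [vFun, B.sFun_π, B.rFun_π, W.v_zero_zero]
    · show χ (B.zL (B.π q)) 0 = χ (B.zL q) 0
      rw [B.zL_π]
    · show χ (B.zL (B.π q)) 1 = χ (B.zL q) 1
      rw [B.zL_π]
  mem_K_iff q hq := by
    rw [hK q hq.1, uFun, vFun, W.u_eq_zero_and_v_eq_zero_iff]

/-- The given point of the box lies in the source of the corner-slice chart built with the
chart `χ = chartAt (zL p)` of `F`. [folklore] -/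
theorem mem_cornerSliceChart_source {ε : ℝ} (hε : 0 < ε) (hεU : ε ≤ B.U.δ) (hεV : ε ≤ B.V.δ)
    {S K : Set X} (hS : ∀ x ∈ B.box ε, x ∈ S ↔ 0 ≤ B.uFun W x ∧ 0 ≤ B.vFun W x)
    (hK : ∀ x ∈ B.box ε, x ∈ K ↔ B.sFun x = 0 ∧ B.rFun x = 0) {p : X} (hp : p ∈ B.box ε) :
    p ∈ (B.cornerSliceChart W (chartAt (𝔼 2) (B.zL p)) ε
      (IsManifold.chart_mem_maximalAtlas (B.zL p)) hε hεU hεV hS hK).Θ.source :=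
  ⟨hp, show B.zL p ∈ (chartAt (𝔼 2) (B.zL p)).source from mem_chart_source _ _⟩

end BiCollar

end Literature.Topology.FourManifolds

end
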